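import Mathlib

/-!
# Simplified-Newton contraction: a zero near an approximate solution — kernel #110 (solo-blind, s61)

Paper §24.61(4)/(6) and §24.62 ((NL-4)∞ / (NL-5)).  The last step of the thin-box construction is a
Newton argument: from an explicit composite approximate solution `z₀` of the steady reduced system
`F(z) = 0`, a bounded (approximate) inverse `A` of the linearisation and a Lipschitz-type control of
`F'` on a ball, one gets a true solution next to `z₀`.  This file is the abstract tool in the
AFFINE-COVARIANT form used in §24.62, where only ONE norm (on the state space) enters — the
quantities `η = ‖A F(z₀)‖` (first Newton correction), `κ = sup ‖I - A F'(x)‖` on the ball, or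
`ω` with `‖I - A F'(x)‖ ≤ ω ‖x - z₀‖`, and the Kantorovich number `h = ω η`:

* `newton_contraction` — `E` complete, `F : E → G` differentiable on `closedBall z₀ r`,
  `A : G →L[ℝ] E` injective with `‖id - A ∘ F'(x)‖ ≤ κ < 1` on the ball, `‖A (F z₀)‖ ≤ η` and
  `η + κ r ≤ r`  ⇒  there is a zero `z` of `F` in the ball, `‖z - z₀‖ ≤ η / (1 - κ)`, and it is
  the only zero of `F` in the ball (Banach fixed point for `Φ x = x - A (F x)` on the complete
  convex ball; mean-value inequality for the contraction constant);
* `newton_kantorovich_affine` — the `ω`-form: `‖id - A ∘ F'(x)‖ ≤ ω ‖x - z₀‖` on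
  `closedBall z₀ (2η)` and `h = ω η ≤ 1/4`  ⇒  a unique zero in `closedBall z₀ (2 η)`.

`A` need not be an exact inverse of `F'(z₀)` (any injective approximate inverse works), which is
the form in which the computed reduced-model constants of §24.62 (η, ω in the inner-weighted
sup-norm `X_A`) are used.  Pure functional analysis, Mathlib only.
-/

namespace Summit.AnomalousDissipation.AnomalousDissipation.Theorems

open Set Metric Function

section Newton

variable {E G : Type*} [NormedAddCommGroup E] [NormedSpace ℝ E] [CompleteSpace E]
  [NormedAddCommGroup G] [NormedSpace ℝ G]

/-- **Simplified-Newton contraction.**  If `‖id - A ∘ F'(x)‖ ≤ κ < 1` on `closedBall z₀ r`,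
`A` is injective, `‖A (F z₀)‖ ≤ η` and `η + κ r ≤ r`, then `F` has exactly one zero in the ball,
and it lies within `η / (1 - κ)` of `z₀`. -/
theorem newton_contraction
    {F : E → G} {F' : E → E →L[ℝ] G} {A : G →L[ℝ] E} {z₀ : E} {r κ η : ℝ}
    (hder : ∀ x ∈ closedBall z₀ r, HasFDerivAt F (F' x) x)
    (hA : Injective A)
    (hκ0 : 0 ≤ κ) (hκ1 : κ < 1)
    (hκ : ∀ x ∈ closedBall z₀ r, ‖ContinuousLinearMap.id ℝ E - A.comp (F' x)‖ ≤ κ)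
    (hη : ‖A (F z₀)‖ ≤ η)
    (hball : η + κ * r ≤ r) :
    ∃ z ∈ closedBall z₀ r, F z = 0 ∧ ‖z - z₀‖ ≤ η / (1 - κ) ∧
      ∀ z' ∈ closedBall z₀ r, F z' = 0 → z' = z := by
  -- the simplified Newton map
  set Φ : E → E := fun x => x - A (F x) with hΦ_def
  have hη0 : 0 ≤ η := le_trans (norm_nonneg _) hη
  have h1κ : 0 < 1 - κ := by linarith
  have hr0 : 0 ≤ r := by nlinarith
  set s : Set E := closedBall z₀ r with hs_def
  have hz₀s : z₀ ∈ s := mem_closedBall_self hr0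
  -- derivative of Φ and its bound on the ball
  have hΦder : ∀ x ∈ s, HasFDerivWithinAt Φ
      (ContinuousLinearMap.id ℝ E - A.comp (F' x)) s x := by
    intro x hx
    have h1 : HasFDerivAt (fun y => A (F y)) (A.comp (F' x)) x :=
      A.hasFDerivAt.comp x (hder x hx)
    exact ((hasFDerivAt_id x).sub h1).hasFDerivWithinAt
  have hlip : ∀ x ∈ s, ∀ y ∈ s, ‖Φ y - Φ x‖ ≤ κ * ‖y - x‖ := fun x hx y hy =>
    (convex_closedBall z₀ r).norm_image_sub_le_of_norm_hasFDerivWithin_le hΦder hκ hx hy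
  -- Φ z₀ - z₀ = -A (F z₀)
  have hΦz₀ : ‖Φ z₀ - z₀‖ ≤ η := by
    have : Φ z₀ - z₀ = -A (F z₀) := by simp [hΦ_def]
    rw [this, norm_neg]; exact hη
  -- Φ maps the ball into itself
  have hmaps : MapsTo Φ s s := by
    intro x hx
    have hx' : ‖x - z₀‖ ≤ r := mem_closedBall_iff_norm.mp hx
    have h1 : ‖Φ x - Φ z₀‖ ≤ κ * ‖x - z₀‖ := hlip z₀ hz₀s x hx
    have h2 : ‖Φ x - z₀‖ ≤ ‖Φ x - Φ z₀‖ + ‖Φ z₀ - z₀‖ := norm_sub_le_norm_sub_add_norm_sub _ _ _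
    have h3 : κ * ‖x - z₀‖ ≤ κ * r := mul_le_mul_of_nonneg_left hx' hκ0
    apply mem_closedBall_iff_norm.mpr
    linarith
  -- contraction on the complete subset s
  have hsc : IsComplete s := isClosed_closedBall.isComplete
  set K : NNReal := ⟨κ, hκ0⟩ with hK_def
  have hKcoe : (K : ℝ) = κ := rfl
  have hKlt : K < 1 := by
    rw [← NNReal.coe_lt_coe, hKcoe]; simpa using hκ1
  have hcontr : ContractingWith K (hmaps.restrict Φ s s) := by
    refine ⟨hKlt, ?_⟩
    refine LipschitzWith.of_dist_le_mul fun x y => ?_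
    have hx := x.2; have hy := y.2
    have := hlip (y : E) hy (x : E) hx
    rw [Subtype.dist_eq, dist_eq_norm, Subtype.dist_eq, dist_eq_norm, hKcoe]
    simpa [MapsTo.restrict, Subtype.map] using this
  obtain ⟨z, hzs, hfix, -⟩ :=
    hcontr.exists_fixedPoint' hsc hmaps hz₀s (edist_ne_top _ _)
  -- the fixed point is a zero of F
  have hFz : F z = 0 := by
    have h1 : z - A (F z) = z := hfix
    have h2 : A (F z) = 0 := by
      have h3 : z - A (F z) - z = 0 := by rw [h1, sub_self]
      simpa using h3
    exact hA (by simpa using h2)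
  refine ⟨z, hzs, hFz, ?_, ?_⟩
  · -- a priori bound ‖z - z₀‖ ≤ η / (1 - κ)
    have h1 : ‖Φ z - Φ z₀‖ ≤ κ * ‖z - z₀‖ := hlip z₀ hz₀s z hzs
    have h2 : ‖z - z₀‖ ≤ ‖Φ z - Φ z₀‖ + ‖Φ z₀ - z₀‖ := by
      have : z - z₀ = (Φ z - Φ z₀) + (Φ z₀ - z₀) := by rw [hfix]; abel
      rw [this]; exact norm_add_le _ _
    rw [le_div_iff₀ h1κ]
    nlinarith
  · -- uniqueness of the zero in the ball
    intro z' hz's hFz'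
    have hfix' : Φ z' = z' := by simp [hΦ_def, hFz']
    have h1 : ‖Φ z' - Φ z‖ ≤ κ * ‖z' - z‖ := hlip z hzs z' hz's
    rw [hfix', hfix] at h1
    have h2 : (1 - κ) * ‖z' - z‖ ≤ 0 := by nlinarith
    have h3 : ‖z' - z‖ ≤ 0 := by
      by_contra hcon
      push Not at hcon
      have := mul_pos h1κ hcon
      linarith
    have h4 : ‖z' - z‖ = 0 := le_antisymm h3 (norm_nonneg _)
    exact sub_eq_zero.mp (norm_eq_zero.mp h4)

/-- **Affine-covariant Newton–Kantorovich (Mysovskikh form).**  If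
`‖id - A ∘ F'(x)‖ ≤ ω ‖x - z₀‖` on `closedBall z₀ (2 η)`, `‖A (F z₀)‖ ≤ η` and the Kantorovich
number satisfies `h = ω η ≤ 1/4`, then `F` has exactly one zero in `closedBall z₀ (2 η)`. -/
theorem newton_kantorovich_affine
    {F : E → G} {F' : E → E →L[ℝ] G} {A : G →L[ℝ] E} {z₀ : E} {ω η : ℝ}
    (hder : ∀ x ∈ closedBall z₀ (2 * η), HasFDerivAt F (F' x) x)
    (hA : Injective A)
    (hω0 : 0 ≤ ω)
    (hω : ∀ x ∈ closedBall z₀ (2 * η),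
      ‖ContinuousLinearMap.id ℝ E - A.comp (F' x)‖ ≤ ω * ‖x - z₀‖)
    (hη : ‖A (F z₀)‖ ≤ η)
    (hh : ω * η ≤ 1 / 4) :
    ∃ z ∈ closedBall z₀ (2 * η), F z = 0 ∧
      ∀ z' ∈ closedBall z₀ (2 * η), F z' = 0 → z' = z := by
  have hη0 : 0 ≤ η := le_trans (norm_nonneg _) hη
  -- apply the contraction theorem with r = 2η, κ = 2 ω η ≤ 1/2
  have hκ0 : 0 ≤ 2 * ω * η := by positivity
  have hκ1 : 2 * ω * η < 1 := by nlinarith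
  have hκ : ∀ x ∈ closedBall z₀ (2 * η),
      ‖ContinuousLinearMap.id ℝ E - A.comp (F' x)‖ ≤ 2 * ω * η := by
    intro x hx
    have hx' : ‖x - z₀‖ ≤ 2 * η := mem_closedBall_iff_norm.mp hx
    calc ‖ContinuousLinearMap.id ℝ E - A.comp (F' x)‖ ≤ ω * ‖x - z₀‖ := hω x hx
      _ ≤ ω * (2 * η) := mul_le_mul_of_nonneg_left hx' hω0
      _ = 2 * ω * η := by ring
  have hball : η + 2 * ω * η * (2 * η) ≤ 2 * η := by nlinarith
  obtain ⟨z, hzs, hFz, -, huniq⟩ :=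
    newton_contraction hder hA hκ0 hκ1 hκ hη hball
  exact ⟨z, hzs, hFz, huniq⟩

end Newton

end Summit.AnomalousDissipation.AnomalousDissipation.Theorems
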